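import Summits.BirchSwinnertonDyer.BirchSwinnertonDyer.Theorems.SylvesterTwoHeegnerIndexUpperOffV0KolyvaginClassesTwoSylvester
import Summits.BirchSwinnertonDyer.BirchSwinnertonDyer.Theorems.SylvesterTwoHeegnerIndexUpperOffV0ReciprocityTwoOfPoitouTate
import Summits.BirchSwinnertonDyer.BirchSwinnertonDyer.Theorems.SylvesterTwoHeegnerIndexUpperOffV0ShaBoundTwoRat
import HarnessLib

/-!
# K7t crux `UpperOffV0HSYPlus` (item 19804), line `offv0-kolyvagin2`: Kolyvagin's theorem AT `p = 2`
# for the Sylvester curves, exponent form, FROM THE PRINTED INPUTS — the line's chain with (d), (e)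
# replaced by their honest antecedents

Helper file of route `SylvesterTwoHeegnerIndex` (cell bsd-cm, rung K7t).  k7t-c2 g4/g5 landed
«(d) + (e) ⟹ `Ш(E_p/K)[2^∞]` finite and killed by `2^{2M₀+4}`» (`sha_two_primary_exponent_of_pointsM_of_reciprocityM`,
`sha_two_exponent_bound_sylvester_of_stubs'`, over `ℚ`: `…_rat_of_stubs`) for the REGISTERED stub
texts (d) `stub_kolyvaginClasses_two` / (e) `stub_kolyvaginReciprocity_two`.  k7t-c2 g6 replaced the two
stubs by their antecedents: (e) ⟸ Poitou–Tate (`kolyvaginReciprocityM_of_poitouTate_anyPrime`), (d) at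
the frame ⟸ {`hrec`, `hCM`, `h53`, `hGZ`} + the `2`-adic local clause `h44`, admissibility discharged
(`hpoints_at_two_of_perLevelChoice_sylvester`).  THIS FILE composes:

* `sha_two_primary_exponent_sylvester_of_perLevelChoice_of_poitouTate` — **for `W` a globally minimal
  `ℚ`-model of `E_p` (`p` an odd prime) at its conductor `N` (`3 ∣ N`), `K` imaginary quadratic with
  `d_K ∉ {−3, −4}` and the Heegner hypothesis, `P` a Heegner point of infinite order: GRANTED the
  Poitou–Tate named fact for `K`, the four cite-only printed inputs {`hrec`, `hCM`, `h53`, `hGZ`} of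
  the odd-`p` X11b road at `2`, and McCallum's Prop. 4.4 at `2` for `E_p` (`h44`), `2^{M₀} ∥ P` in
  `E_p(K)` and `Ш(E_p/K)[2^∞]` is finite and killed by `2^{2M₀+4}`**;
* `sha_two_primary_exponent_sylvester_rat_of_perLevelChoice_of_poitouTate` — the same over `ℚ` in a
  twist-rank-`0` frame (`rank E_p^{(d_K)}(ℚ) = 0`, as in every Heegner frame of the crux), along
  k7t-c2 g0's `shaRestriction_injective_sylvester_of_twist_rank_zero`.

HONEST FRAMING: composition only; what remains labelled is EXACTLY {PT, `hrec`, `hCM`, `h53`, `hGZ`,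
`h44` at `2`} — the first five are the inputs the odd-`p` road also carries (one named fact + four
cite-only printed statements), the last is the one `2`-SPECIFIC open local statement of the line.
This is the C-corrected (C = 4, exponent form) Kolyvagin bound of line `offv0-kolyvagin2`, NOT the crux
(an ORDER bound with defect `0`; B14 = O12 open as a class); no definition, no named fact, no `sorry`;
BSD not claimed.  References: [McCallumLMS1991] §1 Theorem; [GrossLMS1991] Thm. 1.3 (2);
[MilneADT2006] I Thm. 4.10(b); [SilvermanAEC2009] X.4.2.
-/

set_option autoImplicit false
set_option linter.dupNamespace false

noncomputable section

open scoped Classical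
open WeierstrassCurve Field NumberField IsDedekindDomain Finset
open Literature.NumberTheory.EllipticCurves Literature.NumberTheory.GaloisRepresentations
open Literature.NumberTheory.EllipticCurves.KolyvaginCocycle
open Literature.NumberTheory.EllipticCurves.KolyvaginEuler
open Literature.NumberTheory.EllipticCurves.RingClassField
open Literature.NumberTheory.EllipticCurves.ModularForms
open Literature.NumberTheory.GaloisCohomology
open Summit.BirchSwinnertonDyer.Rank1Residual.X11b
open Summit.BirchSwinnertonDyer.Rank1Residual.X11b.KolyvaginAssembly

namespace Summit.BirchSwinnertonDyer.BirchSwinnertonDyer.Theorems.SylvesterTwoUpper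

-- `K : Type`: the tree's ring-class class field theory is universe `0`.
variable {K : Type} [Field K] [NumberField K] {N : ℕ} {W : WeierstrassCurve ℚ}

/-- **Kolyvagin's theorem AT `p = 2` for `E_p` over the Heegner field, exponent form with the `2`-adic
defect, FROM THE PRINTED INPUTS**: for `W` a globally minimal `ℚ`-model of `E_p` (`p` odd prime) at its
conductor `N` (`3 ∣ N`), `K` imaginary quadratic (`d_K ∉ {−3,−4}`, Heegner hypothesis), `P` a Heegner
point of infinite order — GRANTED Poitou–Tate for `K` (`hPT`, named fact), {`hrec`, `hCM`, `h53`,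
`hGZ`} (cite-only printed inputs of the X11b road, at `2`) and McCallum's Prop. 4.4 at `2` for `E_p`
(`h44`, open) — there are `M₀`, `x₀` with `2^{M₀} x₀ = P`, no `Q` with `2^{M₀+1} Q = P`, and
`Ш(E_p/K)[2^∞]` is finite and killed by `2^{2M₀+4}`.  Composition of
`hpoints_at_two_of_perLevelChoice_sylvester` (d at the frame), `kolyvaginReciprocityM_of_poitouTate_anyPrime`
((e) from PT) and k7t-c2 g4's `sha_two_primary_exponent_of_pointsM_of_reciprocityM`, with `∛(432p²) ∉ K`,
`ω ∉ K`, `E_p(K)[2] = 0` discharged as in `sha_two_exponent_bound_sylvester_of_stubs'`.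
[cite: McCallumLMS1991, §1 Theorem (Kolyvagin)] [cite: GrossLMS1991, Thm. 1.3 (2)]
[cite: MilneADT2006, Ch. I Thm. 4.10(b)] -/
theorem sha_two_primary_exponent_sylvester_of_perLevelChoice_of_poitouTate [NeZero N]
    [W.IsGloballyMinimal] [W.IsElliptic]
    (hN : N = W.conductorNorm ℤ) (hK : IsImaginaryQuadratic K)
    (hD34 : NumberField.discr K ≠ -3 ∧ NumberField.discr K ≠ -4)
    (hH : SatisfiesHeegnerHypothesis N K) {P : (W.baseChange K).toAffine.Point}
    (hHP : IsHeegnerPoint N W K P) (hnt : ¬ IsOfFinAddOrder P) {p : ℕ} (hp : p.Prime) (hp2 : p ≠ 2)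
    (hW : ∃ C : VariableChange ℚ, C • W = HuShuYin2019.cubeSumCurve (p : ℚ)) (h3N : 3 ∣ N)
    (hPT : poitouTate_sum_localTatePairing_eq_zero K)
    (hrec : heegnerPointOfConductor_one_galoisConj N W K)
    (hCM : ∀ [W.IsElliptic] (_hK : IsImaginaryQuadratic K) (_hH : SatisfiesHeegnerHypothesis N K)
      (Dt : ModularParametrizationData W N) (β : ℤ) (ι : K →+* ℂ),
      (4 * N : ℤ) ∣ β ^ 2 - NumberField.discr K →
      ∀ {M : ℕ}, 1 ≤ M → ∀ (m : ℕ), Squarefree m →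
      (∀ q ∈ m.primeFactors, IsKolyvaginPrime N W K 2 q ∧ FrobEqFrobInfty W K (2 ^ M) q) →
      ∃ y : (W.baseChange (ringClassField K ι m)).toAffine.Point,
        WeierstrassCurve.Affine.Point.map (W' := W) (ringClassField K ι m).subtype.toRatAlgHom y =
          heegnerPointComplexOfConductor Dt (NumberField.discr K) β m)
    (h53 : ∀ [W.IsElliptic] (_hK : IsImaginaryQuadratic K) (_hH : SatisfiesHeegnerHypothesis N K)
      (Dt : ModularParametrizationData W N) (β : ℤ) (ι : K →+* ℂ) {M : ℕ}
      (_hM : 1 ≤ M) {n : ℕ} (_hn : Squarefree n)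
      (_hKol : ∀ q ∈ n.primeFactors, IsKolyvaginPrime N W K 2 q ∧ FrobEqFrobInfty W K (2 ^ M) q)
      (d : (m : ℕ) → m ∣ n → KolyvaginHeegnerData Dt β ι m) (m : ℕ) (hm : m ∣ n)
      (τm : ringClassField K ι m ≃ₐ[ℚ] ringClassField K ι m),
      (∀ x : ringClassField K ι m, ((τm x : ringClassField K ι m) : ℂ) = starRingEnd ℂ x) →
      ∃ σ' ∈ ringClassGal ι m, IsOfFinAddOrder
        (pointGalHom W (ringClassField K ι m) τm (d m hm).y -
          (-W.rootNumber) • pointGalHom W (ringClassField K ι m) σ' (d m hm).y))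
    (hGZ : ∀ [W.IsElliptic] (_hK : IsImaginaryQuadratic K) (_hH : SatisfiesHeegnerHypothesis N K)
      (Dt : ModularParametrizationData W N) (β : ℤ) (ι : K →+* ℂ) {M : ℕ} (_hM : 1 ≤ M) {n : ℕ}
      (_hn : Squarefree n)
      (_hKol : ∀ q ∈ n.primeFactors, IsKolyvaginPrime N W K 2 q ∧ FrobEqFrobInfty W K (2 ^ M) q)
      (d : (m : ℕ) → m ∣ n → KolyvaginHeegnerData Dt β ι m),
      ∃ n' : ℤ, IsCoprime ((2 ^ M : ℕ) : ℤ) n' ∧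
        ∀ (m : ℕ) (hm : m ∣ n) (γ : ringClassField K ι m ≃ₐ[ℚ] ringClassField K ι m),
          γ ∈ ringClassGal ι m → ∀ v : HeightOneSpectrum (𝓞 K),
            ¬ (W.baseChange K).HasGoodReductionAt v →
            n' • pointsMap (W.baseChange K) (v.adicCompletion K)
                ((d m hm).toGeomPoints (pointGalHom W (ringClassField K ι m) γ (d m hm).y)) ∈
              E0Receptacle (W.baseChange K) v ∧
            ∀ (ℓ : ℕ) (hℓ : ℓ ∈ m.primeFactors)
              (hle : ringClassField K ι (m / ℓ) ≤ ringClassField K ι m),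
              n' • pointsMap (W.baseChange K) (v.adicCompletion K)
                  ((d m hm).toGeomPoints (pointGalHom W (ringClassField K ι m) γ
                    (WeierstrassCurve.Affine.Point.map (W' := W)
                      ((RingClassField.inclusion ι hle).restrictScalars ℚ)
                      (d (m / ℓ)
                        ((Nat.div_dvd_of_dvd (Nat.dvd_of_mem_primeFactors hℓ)).trans hm)).y))) ∈
                E0Receptacle (W.baseChange K) v)
    (h44 : ∀ [W.IsElliptic] [W.IsGloballyMinimal] (_hK : IsImaginaryQuadratic K) (ι : K →+* ℂ)
      {P : (W.baseChange K).toAffine.Point} (_hHP : IsHeegnerPoint N W K P) {M : ℕ} (_hM : 1 ≤ M)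
      (Dt : ModularParametrizationData W N) {β : ℤ}
      (_hND : IsCoprime (N : ℤ) (NumberField.discr K)) (_hD : NumberField.discr K < -4)
      {n : ℕ} (_hn : Squarefree n)
      (_hKol : ∀ q ∈ n.primeFactors, IsKolyvaginPrime N W K 2 q ∧ FrobEqFrobInfty W K (2 ^ M) q)
      (d : (m : ℕ) → m ∣ n → KolyvaginHeegnerData Dt β ι m)
      (_hcoh : ∀ (m : ℕ) (hm : m ∣ n) (ℓ : ℕ) (hℓ : ℓ ∈ m.primeFactors)
        (hle : ringClassField K ι (m / ℓ) ≤ ringClassField K ι m),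
        letI : Algebra K ℂ := ι.toAlgebra
        (d m hm).toGeomPoints
            (KolyvaginOperator.derivedPoint (pointGalHom W (ringClassField K ι m)) (d m hm).σ (m / ℓ)
              (d m hm).S
              (WeierstrassCurve.Affine.Point.map (W' := W)
                ((RingClassField.inclusion ι hle).restrictScalars ℚ)
                (d (m / ℓ) ((Nat.div_dvd_of_dvd (Nat.dvd_of_mem_primeFactors hℓ)).trans hm)).y)) =
          (d (m / ℓ) ((Nat.div_dvd_of_dvd (Nat.dvd_of_mem_primeFactors hℓ)).trans hm)).toGeomPoints
            (d (m / ℓ) ((Nat.div_dvd_of_dvd (Nat.dvd_of_mem_primeFactors hℓ)).trans hm)).derivedPoint)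
      (_hA : ∀ (m : ℕ) (hm : m ∣ n),
        IsAdmissible (absoluteGaloisGroup K) (d m hm).pointsSubgroup ((2 ^ M : ℕ) : ℤ))
      (_hPt : ∀ (m : ℕ) (hm : m ∣ n),
        (d m hm).toGeomPoints (d m hm).derivedPoint ∈
          invPoints (absoluteGaloisGroup K) (d m hm).pointsSubgroup ((2 ^ M : ℕ) : ℤ))
      (_hI : ∀ (m : ℕ) (hm : m ∣ n), ∀ v : HeightOneSpectrum (𝓞 K), (m : 𝓞 K) ∉ v.asIdeal →
        ∀ 𝔐 ∈ v.localPrimesAbove, ∀ t ∈ 𝔐.inertia (absoluteGaloisGroup (v.adicCompletion K)),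
          resGal (K := K) (v.adicCompletion K) t • (d m hm).toGeomPoints (d m hm).derivedPoint =
            (d m hm).toGeomPoints (d m hm).derivedPoint),
      ∀ (m : ℕ) (hm : m ∣ n) (ℓ : ℕ), ℓ.Prime → ∀ (hℓm : ℓ ∣ m) (v : HeightOneSpectrum (𝓞 K)),
        (ℓ : 𝓞 K) ∈ v.asIdeal → ∀ a : ℕ,
          ((((2 : ℕ) : ℤ) ^ a) • (d m hm).kolyvaginClass Nat.prime_two M ∈
              selmerLocalKer (W.baseChange K) (v.adicCompletion K) ((2 ^ M : ℕ) : ℤ) ↔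
            (((2 : ℕ) : ℤ) ^ a) • (d (m / ℓ) ((Nat.div_dvd_of_dvd hℓm).trans hm)).kolyvaginClass Nat.prime_two M ∈
              (W.baseChange K).torsionLocalKer (v.adicCompletion K) ((2 ^ M : ℕ) : ℤ))) :
    ∃ (M₀ : ℕ) (x₀ : (W.baseChange K).toAffine.Point),
      2 ^ M₀ • x₀ = P ∧ (∀ Q : (W.baseChange K).toAffine.Point, 2 ^ (M₀ + 1) • Q ≠ P) ∧
      (∀ cs : (W.baseChange K).sha, (∃ j : ℕ, 2 ^ j • cs = 0) → 2 ^ (2 * M₀ + 4) • cs = 0) ∧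
      Set.Finite {cs : (W.baseChange K).sha | ∃ j : ℕ, 2 ^ j • cs = 0} := by
  -- the Mordell model `C • W = y² = x³ − 432p²`, `∛(432p²) ∉ K`, `ω ∉ K`, `E_p(K)[2] = 0`
  obtain ⟨C, hCW⟩ := hW
  have hCW' : C • W = ⟨0, 0, 0, 0, -(432 * (p : ℚ) ^ 2)⟩ := by
    rw [hCW, HuShuYin2019.cubeSumCurve]; congr 1; ring
  have hcube : ∀ x : K, x ^ 3 ≠ ((432 * (p : ℚ) ^ 2 : ℚ) : K) := fun x h =>
    SylvesterTwoFrame.cube_ne_432_mul_sq_of_finrank_eq_two K hK.1 hp hp2 x (by rw [h]; simp)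
  have hA2 : ∀ a : (W.baseChange K).toAffine.Point, 2 • a = 0 → a = 0 :=
    SylvesterTwoFrame.two_torsion_eq_zero_of_model_of_isImaginaryQuadratic K hK hp hp2 W ⟨C, hCW⟩
  have hωK : ∀ x : K, x ^ 2 + x + 1 ≠ 0 := sq_add_self_add_one_ne_zero_of_discr_ne hK hD34.1
  exact sha_two_primary_exponent_of_pointsM_of_reciprocityM (N := N) W hK hCW' hcube hωK hA2 hHP hnt
    (fun {M} hM hdiv c hc ↦ hpoints_at_two_of_perLevelChoice_sylvester hN hK hD34 hH hHP hp hp2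
      ⟨C, hCW⟩ h3N hrec hCM h53 hGZ h44 hM hdiv c hc)
    (fun {M} hM {ℓ} hℓ hℓM ↦ kolyvaginReciprocityM_of_poitouTate_anyPrime N W K hPT hK hD34 hH hHP hnt
      Nat.prime_two hM hℓ hℓM)

/-- **The same over `ℚ` in a twist-rank-`0` frame**: if moreover `rank E_p^{(d_K)}(ℚ) = 0` (as in
every Heegner frame of the crux: `L(E_p^{(d_K)}, 1) ≠ 0` + GZK), then `Ш(E_p/ℚ)[2^∞]` is finite and
killed by `2^{2M₀+4}` — transport along the injective restriction `Ш(E_p/ℚ) → Ш(E_p/K)` (k7t-c2 g0's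
`shaRestriction_injective_sylvester_of_twist_rank_zero`, g5's `twoPrimary_exponent_of_injective`).
Labelled inputs exactly as in `sha_two_primary_exponent_sylvester_of_perLevelChoice_of_poitouTate`.
[cite: McCallumLMS1991, §1 Theorem (Kolyvagin)] [cite: GrossLMS1991, Thm. 1.3 (2), §2] -/
theorem sha_two_primary_exponent_sylvester_rat_of_perLevelChoice_of_poitouTate [NeZero N]
    [W.IsGloballyMinimal] [W.IsElliptic]
    (hN : N = W.conductorNorm ℤ) (hK : IsImaginaryQuadratic K)
    (hD34 : NumberField.discr K ≠ -3 ∧ NumberField.discr K ≠ -4)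
    (hH : SatisfiesHeegnerHypothesis N K) {P : (W.baseChange K).toAffine.Point}
    (hHP : IsHeegnerPoint N W K P) (hnt : ¬ IsOfFinAddOrder P) {p : ℕ} (hp : p.Prime) (hp2 : p ≠ 2)
    (hW : ∃ C : VariableChange ℚ, C • W = HuShuYin2019.cubeSumCurve (p : ℚ)) (h3N : 3 ∣ N)
    (htwist : (W.quadraticTwist (NumberField.discr K : ℚ)).mordellWeilRank = 0)
    (hPT : poitouTate_sum_localTatePairing_eq_zero K)
    (hrec : heegnerPointOfConductor_one_galoisConj N W K)
    (hCM : ∀ [W.IsElliptic] (_hK : IsImaginaryQuadratic K) (_hH : SatisfiesHeegnerHypothesis N K)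
      (Dt : ModularParametrizationData W N) (β : ℤ) (ι : K →+* ℂ),
      (4 * N : ℤ) ∣ β ^ 2 - NumberField.discr K →
      ∀ {M : ℕ}, 1 ≤ M → ∀ (m : ℕ), Squarefree m →
      (∀ q ∈ m.primeFactors, IsKolyvaginPrime N W K 2 q ∧ FrobEqFrobInfty W K (2 ^ M) q) →
      ∃ y : (W.baseChange (ringClassField K ι m)).toAffine.Point,
        WeierstrassCurve.Affine.Point.map (W' := W) (ringClassField K ι m).subtype.toRatAlgHom y =
          heegnerPointComplexOfConductor Dt (NumberField.discr K) β m)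
    (h53 : ∀ [W.IsElliptic] (_hK : IsImaginaryQuadratic K) (_hH : SatisfiesHeegnerHypothesis N K)
      (Dt : ModularParametrizationData W N) (β : ℤ) (ι : K →+* ℂ) {M : ℕ}
      (_hM : 1 ≤ M) {n : ℕ} (_hn : Squarefree n)
      (_hKol : ∀ q ∈ n.primeFactors, IsKolyvaginPrime N W K 2 q ∧ FrobEqFrobInfty W K (2 ^ M) q)
      (d : (m : ℕ) → m ∣ n → KolyvaginHeegnerData Dt β ι m) (m : ℕ) (hm : m ∣ n)
      (τm : ringClassField K ι m ≃ₐ[ℚ] ringClassField K ι m),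
      (∀ x : ringClassField K ι m, ((τm x : ringClassField K ι m) : ℂ) = starRingEnd ℂ x) →
      ∃ σ' ∈ ringClassGal ι m, IsOfFinAddOrder
        (pointGalHom W (ringClassField K ι m) τm (d m hm).y -
          (-W.rootNumber) • pointGalHom W (ringClassField K ι m) σ' (d m hm).y))
    (hGZ : ∀ [W.IsElliptic] (_hK : IsImaginaryQuadratic K) (_hH : SatisfiesHeegnerHypothesis N K)
      (Dt : ModularParametrizationData W N) (β : ℤ) (ι : K →+* ℂ) {M : ℕ} (_hM : 1 ≤ M) {n : ℕ}
      (_hn : Squarefree n)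
      (_hKol : ∀ q ∈ n.primeFactors, IsKolyvaginPrime N W K 2 q ∧ FrobEqFrobInfty W K (2 ^ M) q)
      (d : (m : ℕ) → m ∣ n → KolyvaginHeegnerData Dt β ι m),
      ∃ n' : ℤ, IsCoprime ((2 ^ M : ℕ) : ℤ) n' ∧
        ∀ (m : ℕ) (hm : m ∣ n) (γ : ringClassField K ι m ≃ₐ[ℚ] ringClassField K ι m),
          γ ∈ ringClassGal ι m → ∀ v : HeightOneSpectrum (𝓞 K),
            ¬ (W.baseChange K).HasGoodReductionAt v →
            n' • pointsMap (W.baseChange K) (v.adicCompletion K)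
                ((d m hm).toGeomPoints (pointGalHom W (ringClassField K ι m) γ (d m hm).y)) ∈
              E0Receptacle (W.baseChange K) v ∧
            ∀ (ℓ : ℕ) (hℓ : ℓ ∈ m.primeFactors)
              (hle : ringClassField K ι (m / ℓ) ≤ ringClassField K ι m),
              n' • pointsMap (W.baseChange K) (v.adicCompletion K)
                  ((d m hm).toGeomPoints (pointGalHom W (ringClassField K ι m) γ
                    (WeierstrassCurve.Affine.Point.map (W' := W)
                      ((RingClassField.inclusion ι hle).restrictScalars ℚ)
                      (d (m / ℓ)
                        ((Nat.div_dvd_of_dvd (Nat.dvd_of_mem_primeFactors hℓ)).trans hm)).y))) ∈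
                E0Receptacle (W.baseChange K) v)
    (h44 : ∀ [W.IsElliptic] [W.IsGloballyMinimal] (_hK : IsImaginaryQuadratic K) (ι : K →+* ℂ)
      {P : (W.baseChange K).toAffine.Point} (_hHP : IsHeegnerPoint N W K P) {M : ℕ} (_hM : 1 ≤ M)
      (Dt : ModularParametrizationData W N) {β : ℤ}
      (_hND : IsCoprime (N : ℤ) (NumberField.discr K)) (_hD : NumberField.discr K < -4)
      {n : ℕ} (_hn : Squarefree n)
      (_hKol : ∀ q ∈ n.primeFactors, IsKolyvaginPrime N W K 2 q ∧ FrobEqFrobInfty W K (2 ^ M) q)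
      (d : (m : ℕ) → m ∣ n → KolyvaginHeegnerData Dt β ι m)
      (_hcoh : ∀ (m : ℕ) (hm : m ∣ n) (ℓ : ℕ) (hℓ : ℓ ∈ m.primeFactors)
        (hle : ringClassField K ι (m / ℓ) ≤ ringClassField K ι m),
        letI : Algebra K ℂ := ι.toAlgebra
        (d m hm).toGeomPoints
            (KolyvaginOperator.derivedPoint (pointGalHom W (ringClassField K ι m)) (d m hm).σ (m / ℓ)
              (d m hm).S
              (WeierstrassCurve.Affine.Point.map (W' := W)
                ((RingClassField.inclusion ι hle).restrictScalars ℚ)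
                (d (m / ℓ) ((Nat.div_dvd_of_dvd (Nat.dvd_of_mem_primeFactors hℓ)).trans hm)).y)) =
          (d (m / ℓ) ((Nat.div_dvd_of_dvd (Nat.dvd_of_mem_primeFactors hℓ)).trans hm)).toGeomPoints
            (d (m / ℓ) ((Nat.div_dvd_of_dvd (Nat.dvd_of_mem_primeFactors hℓ)).trans hm)).derivedPoint)
      (_hA : ∀ (m : ℕ) (hm : m ∣ n),
        IsAdmissible (absoluteGaloisGroup K) (d m hm).pointsSubgroup ((2 ^ M : ℕ) : ℤ))
      (_hPt : ∀ (m : ℕ) (hm : m ∣ n),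
        (d m hm).toGeomPoints (d m hm).derivedPoint ∈
          invPoints (absoluteGaloisGroup K) (d m hm).pointsSubgroup ((2 ^ M : ℕ) : ℤ))
      (_hI : ∀ (m : ℕ) (hm : m ∣ n), ∀ v : HeightOneSpectrum (𝓞 K), (m : 𝓞 K) ∉ v.asIdeal →
        ∀ 𝔐 ∈ v.localPrimesAbove, ∀ t ∈ 𝔐.inertia (absoluteGaloisGroup (v.adicCompletion K)),
          resGal (K := K) (v.adicCompletion K) t • (d m hm).toGeomPoints (d m hm).derivedPoint =
            (d m hm).toGeomPoints (d m hm).derivedPoint),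
      ∀ (m : ℕ) (hm : m ∣ n) (ℓ : ℕ), ℓ.Prime → ∀ (hℓm : ℓ ∣ m) (v : HeightOneSpectrum (𝓞 K)),
        (ℓ : 𝓞 K) ∈ v.asIdeal → ∀ a : ℕ,
          ((((2 : ℕ) : ℤ) ^ a) • (d m hm).kolyvaginClass Nat.prime_two M ∈
              selmerLocalKer (W.baseChange K) (v.adicCompletion K) ((2 ^ M : ℕ) : ℤ) ↔
            (((2 : ℕ) : ℤ) ^ a) • (d (m / ℓ) ((Nat.div_dvd_of_dvd hℓm).trans hm)).kolyvaginClass Nat.prime_two M ∈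
              (W.baseChange K).torsionLocalKer (v.adicCompletion K) ((2 ^ M : ℕ) : ℤ))) :
    ∃ (M₀ : ℕ) (x₀ : (W.baseChange K).toAffine.Point),
      2 ^ M₀ • x₀ = P ∧ (∀ Q : (W.baseChange K).toAffine.Point, 2 ^ (M₀ + 1) • Q ≠ P) ∧
      (∀ cs : W.sha, (∃ j : ℕ, 2 ^ j • cs = 0) → 2 ^ (2 * M₀ + 4) • cs = 0) ∧
      Set.Finite {cs : W.sha | ∃ j : ℕ, 2 ^ j • cs = 0} := by
  obtain ⟨M₀, x₀, hx₀, hmax, hkill, hfin⟩ :=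
    sha_two_primary_exponent_sylvester_of_perLevelChoice_of_poitouTate hN hK hD34 hH hHP hnt hp hp2 hW
      h3N hPT hrec hCM h53 hGZ h44
  have hinj : Function.Injective (shaRestriction W K) :=
    shaRestriction_injective_sylvester_of_twist_rank_zero hp hp2 W hW K hK.1 htwist
  obtain ⟨hkillQ, hfinQ⟩ :=
    twoPrimary_exponent_of_injective (shaRestriction W K) hinj 2 (2 * M₀ + 4) hkill hfin
  exact ⟨M₀, x₀, hx₀, hmax, hkillQ, hfinQ⟩

end Summit.BirchSwinnertonDyer.BirchSwinnertonDyer.Theorems.SylvesterTwoUpper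

end
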